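/-
Copyright (c) 2026. All rights reserved.
Released under Apache 2.0 license as described in the file LICENSE.
-/
import Literature.NumberTheory.Automorphic.MaximalOrderDiscThreeBrandtSetup
import Literature.NumberTheory.Automorphic.RamifiedPrimeIdeal
import Literature.NumberTheory.Automorphic.BrandtIndexReducedNorm
import HarnessLib

/-!
# The ramified prime of the maximal order `O₃` of `(−1,−3 ∣ ℚ)`: the unique two-sided prime ideal above `3` is principal,
# `𝔓 = {x ∈ O₃ : 3 ∣ nrd x} = jO₃ = O₃j` with the uniformiser `j = 2ω − 1` (`nrd j = 3`, `j² = −3`), `[O₃ : 𝔓] = 9`, `𝔓² = 3O₃`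

[tag: quaternion_algebra] [tag: maximal_order] [tag: ramification]

Topic `NumberTheory/Automorphic`; THEOREMS ONLY (no definition, no named fact, no instance; net Literature debt `0`).
Lane `lit-hodgefound`, seat p12, gen 45 — ninth file of the series on the definite quaternion order of discriminant `3`.

Vignéras II §1 (Lemme 1.5, Cor. 1.7): at a ramified prime `p` the completed maximal order is the valuation ring of the local
division algebra, its maximal ideal `P = {h : w(h) > 0} = Ou = uO` is two-sided and principal, generated by any element of
reduced norm exactly divisible by `p`, `P² = pO`, and `O/P` is the field with `p²` elements; Voight 13.3 (13.3.4, Thm. 13.3.11).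
For `O₃ = ℤ⟨1, i, ω, iω⟩ ⊂ (−1,−3 ∣ ℚ)` (`ω = (1 + j)/2`) and `p = 3` everything is explicit and GLOBAL (class number one):
the tree's `normPrimeIdeal O₃ 3` (`RamifiedPrimeIdeal.lean`: the span of `{x ∈ O₃ : 3 ∣ nrd x}`) is the principal two-sided
ideal generated by `j = 2ω − 1`, because in the coordinates `x = a + bi + cω + d iω` one has `3 ∣ nrd x = a² + ac + c² + b² + bd + d²`
iff `a ≡ c` and `b ≡ d (mod 3)` iff `x ∈ jO₃` (left multiplication by `j` is `(A,B,C,D) ↦ (−A − 2C, B + 2D, 2A + C, −2B − D)`,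
cf. `MaximalOrderDiscThreeNormsThreeMul`):

* §1 the uniformiser: `basisJ_eq_two_omega_sub_one` (`j = 2ω − 1`), `reducedNorm_basisJ` (`nrd j = 3`), `basisJ_mul_basisJ`
  (`j² = −3`), `basisJ_mul_basisJInv`, `basisJInv_mul_basisJ`, **`basisJ_mul_mk`** (`j·(A + Bi + Cω + D iω) =
  (−A−2C) + (B+2D)i + (2A+C)ω + (−2B−D)iω`), **`mk_mul_basisJ`** (`x·j = j·x'` with `x' = a − bi + cω − d iω`: `jO₃ = O₃j`),
  `basisJ_mul_mk_eq_mul_basisJ`;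
* §2 **`exists_eq_basisJ_mul_iff`** (for `x ∈ O₃`: **`x ∈ jO₃ ⟺ 3 ∣ nrd x`**), `exists_eq_mul_basisJ_iff` (`x ∈ O₃j ⟺ x ∈ jO₃`);
* §3 the ideal: `mem_basisJUnit_smul_iff`, **`normPrimeIdeal_three_eq`** (**`𝔓 := normPrimeIdeal O₃ 3 = jO₃`** — VIGNÉRAS II §1
  LEMME 1.5 ∕ VOIGHT 13.3 for this order), `coe_basisJUnit_smul_eq` (`jO₃ = O₃j` as sets: `𝔓` is two-sided),
  **`relIndex_basisJUnit_smul`** (`[O₃ : 𝔓] = 9 = 3²`), `relIndex_normPrimeIdeal_three`, `mem_basisJUnit_smul_smul_iff`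
  (`𝔓² = jjO₃ = 3O₃`: `x ∈ 𝔓² ⟺ x = 3y`, `y ∈ O₃`), **`units_smul_eq_basisJUnit_smul_of_reducedNorm_eq_three`** (every
  `u ∈ O₃` with `nrd u = 3` generates `𝔓`: `uO₃ = jO₃` — the `12` elements of reduced norm `3` are the `ju`, `u ∈ O₃^×`,
  matching `T(3) = 1`).

## Sources

* M.-F. Vignéras, *Arithmétique des algèbres de quaternions*, LNM 800 (1980), Ch. II §1 Lemme 1.5, Cor. 1.7 (`P = Ou = uO`,
  `P² = pO` at a ramified prime). [cite: VignerasLNM800, Ch. II §1 Lemme 1.5 and Cor. 1.7]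
* J. Voight, *Quaternion Algebras*, GTM 288 (2021), 13.3.4, Thm. 13.3.11 (valuation ring, unique maximal ideal `P = OjO = jO`),
  Exercise 11.12, (11.5.12). [cite: Voight2021, §13.3 Thm. 13.3.11; Exercise 11.12]

## Scope (honest)

Theorems only — no definition, no named fact, no instance. The residue field statement `O₃/𝔓 ≅ 𝔽₉` is recorded only as the
index `[O₃ : 𝔓] = 9`; the local (completed) statements of Vignéras II §1 are not restated.
-/

open Quaternion
open scoped Pointwise
open Literature.NumberTheory.Automorphic.Brandt

namespace Literature.NumberTheory.Automorphic.MaxOrderDiscThree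

/-! ## §1 The uniformiser `j = 2ω − 1` -/

section Uniformiser

/-- `j = 2ω − 1` (`ω = (1 + j)/2`). [cite: Voight2021, Exercise 11.12] -/
theorem basisJ_eq_two_omega_sub_one : (⟨0, 0, 1, 0⟩ : ℍ[ℚ,-1,-3]) = (2 : ℚ) • ⟨1/2, 0, 1/2, 0⟩ - 1 := by
  ext <;> simp

/-- **`nrd j = 3`.** [cite: Voight2021, Exercise 11.12] -/
theorem reducedNorm_basisJ : reducedNorm ℚ ℍ[ℚ,-1,-3] (⟨0, 0, 1, 0⟩ : ℍ[ℚ,-1,-3]) = 3 := by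
  rw [reducedNorm_eq]
  norm_num

/-- `j² = −3`. [cite: Voight2021, Exercise 11.12] -/
theorem basisJ_mul_basisJ : (⟨0, 0, 1, 0⟩ : ℍ[ℚ,-1,-3]) * ⟨0, 0, 1, 0⟩ = ⟨-3, 0, 0, 0⟩ := by
  ext <;> norm_num [QuaternionAlgebra.mk_mul_mk]

/-- `j · (−j/3) = 1` (`j² = −3`). [cite: Voight2021, Exercise 11.12] -/
theorem basisJ_mul_basisJInv : (⟨0, 0, 1, 0⟩ : ℍ[ℚ,-1,-3]) * ⟨0, 0, -1/3, 0⟩ = 1 := by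
  ext <;> norm_num [QuaternionAlgebra.mk_mul_mk]

/-- `(−j/3) · j = 1`. [cite: Voight2021, Exercise 11.12] -/
theorem basisJInv_mul_basisJ : (⟨0, 0, -1/3, 0⟩ : ℍ[ℚ,-1,-3]) * ⟨0, 0, 1, 0⟩ = 1 := by
  ext <;> norm_num [QuaternionAlgebra.mk_mul_mk]

/-- **Left multiplication by `j` in the coordinates of `O₃`: `j·(A + Bi + Cω + D iω) = (−A − 2C) + (B + 2D)i + (2A + C)ω + (−2B − D)iω`**
(`ωi = iω̄`, `ω² = ω − 1`, `ω iω = i`). [cite: Voight2021, 11.5.12] -/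
theorem basisJ_mul_mk (A B C D : ℤ) :
    (⟨0, 0, 1, 0⟩ : ℍ[ℚ,-1,-3]) * ⟨(A : ℚ) + (C : ℚ) / 2, (B : ℚ) + (D : ℚ) / 2, (C : ℚ) / 2, (D : ℚ) / 2⟩ =
      ⟨((-A - 2 * C : ℤ) : ℚ) + ((2 * A + C : ℤ) : ℚ) / 2, ((B + 2 * D : ℤ) : ℚ) + ((-2 * B - D : ℤ) : ℚ) / 2,
        ((2 * A + C : ℤ) : ℚ) / 2, ((-2 * B - D : ℤ) : ℚ) / 2⟩ := by
  ext <;> simp [QuaternionAlgebra.mk_mul_mk] <;> ring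

/-- **`jO₃ = O₃j` elementwise: `(a + bi + cω + d iω)·j = j·(a − bi + cω − d iω)`** (conjugation by `j` fixes `ω` and negates
`i`). [cite: VignerasLNM800, Ch. II §1 Lemme 1.5] -/
theorem mk_mul_basisJ (a b c d : ℤ) :
    (⟨(a : ℚ) + (c : ℚ) / 2, (b : ℚ) + (d : ℚ) / 2, (c : ℚ) / 2, (d : ℚ) / 2⟩ : ℍ[ℚ,-1,-3]) * ⟨0, 0, 1, 0⟩ =
      ⟨0, 0, 1, 0⟩ * ⟨(a : ℚ) + (c : ℚ) / 2, ((-b : ℤ) : ℚ) + ((-d : ℤ) : ℚ) / 2, (c : ℚ) / 2, ((-d : ℤ) : ℚ) / 2⟩ := by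
  ext <;> simp [QuaternionAlgebra.mk_mul_mk] <;> ring

/-- `j·(a + bi + cω + d iω) = (a − bi + cω − d iω)·j`. [cite: VignerasLNM800, Ch. II §1 Lemme 1.5] -/
theorem basisJ_mul_mk_eq_mul_basisJ (a b c d : ℤ) :
    (⟨0, 0, 1, 0⟩ : ℍ[ℚ,-1,-3]) * ⟨(a : ℚ) + (c : ℚ) / 2, (b : ℚ) + (d : ℚ) / 2, (c : ℚ) / 2, (d : ℚ) / 2⟩ =
      ⟨(a : ℚ) + (c : ℚ) / 2, ((-b : ℤ) : ℚ) + ((-d : ℤ) : ℚ) / 2, (c : ℚ) / 2, ((-d : ℤ) : ℚ) / 2⟩ * ⟨0, 0, 1, 0⟩ := by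
  ext <;> simp [QuaternionAlgebra.mk_mul_mk] <;> ring

end Uniformiser

/-! ## §2 `x ∈ jO₃ ⟺ 3 ∣ nrd x` -/

section Divisibility

/-- `3 ∣ a² + ac + c² + b² + bd + d² ⟺ a ≡ c ∧ b ≡ d (mod 3)` (cf. `MaximalOrderDiscThreeNormsThreeMul.three_dvd_form_iff`; repeated
here to keep the two files independent). [cite: Voight2021, §13.3] -/
private theorem three_dvd_form_iff₉ (a b c d : ℤ) :
    (3 : ℤ) ∣ a ^ 2 + a * c + c ^ 2 + b ^ 2 + b * d + d ^ 2 ↔ (3 : ℤ) ∣ a - c ∧ (3 : ℤ) ∣ b - d := by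
  have key : ∀ x y z w : ZMod 3, x ^ 2 + x * z + z ^ 2 + y ^ 2 + y * w + w ^ 2 = 0 ↔ x = z ∧ y = w := by decide
  have e₁ := ZMod.intCast_zmod_eq_zero_iff_dvd (a ^ 2 + a * c + c ^ 2 + b ^ 2 + b * d + d ^ 2) 3
  have e₂ := ZMod.intCast_zmod_eq_zero_iff_dvd (a - c) 3
  have e₃ := ZMod.intCast_zmod_eq_zero_iff_dvd (b - d) 3
  push_cast at e₁ e₂ e₃
  rw [← e₁, ← e₂, ← e₃, sub_eq_zero, sub_eq_zero]
  exact key _ _ _ _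

/-- **For `x ∈ O₃`: `x ∈ jO₃` iff `3 ∣ nrd x`** (`⟸`: `a ≡ c`, `b ≡ d (mod 3)` and `x = j·y` with
`y = (a+2c)/3 − ((b+2d)/3)i − ((2a+c)/3)ω + ((2b+d)/3)iω ∈ O₃`; `⟹`: `nrd(jy) = 3·nrd y`). [cite: VignerasLNM800, Ch. II §1 Lemme 1.5] [cite: Voight2021, §13.3 Thm. 13.3.11] -/
theorem exists_eq_basisJ_mul_iff {x : ℍ[ℚ,-1,-3]} (hx : x ∈ (Submodule.span ℤ (Set.range ![(⟨1, 0, 0, 0⟩ : ℍ[ℚ,-1,-3]), ⟨0, 1, 0, 0⟩, ⟨1/2, 0, 1/2, 0⟩, ⟨0, 1/2, 0, 1/2⟩]))) :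
    (∃ y ∈ (Submodule.span ℤ (Set.range ![(⟨1, 0, 0, 0⟩ : ℍ[ℚ,-1,-3]), ⟨0, 1, 0, 0⟩, ⟨1/2, 0, 1/2, 0⟩, ⟨0, 1/2, 0, 1/2⟩])), x = ⟨0, 0, 1, 0⟩ * y) ↔ ∃ n : ℤ, reducedNorm ℚ ℍ[ℚ,-1,-3] x = 3 * n := by
  haveI := isQuaternionAlgebra
  constructor
  · rintro ⟨y, hy, rfl⟩
    obtain ⟨m, hm⟩ := exists_reducedNorm_eq_natCast_of_mem hy
    refine ⟨m, ?_⟩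
    rw [reducedNorm_mul_holds ℚ ℍ[ℚ,-1,-3], reducedNorm_basisJ, hm]
    push_cast
    ring
  · rintro ⟨n, hn⟩
    obtain ⟨a, b, c, d, rfl⟩ := (mem_lattice_iff x).1 hx
    rw [reducedNorm_mk] at hn
    have h3 : (3 : ℤ) ∣ a ^ 2 + a * c + c ^ 2 + b ^ 2 + b * d + d ^ 2 := ⟨n, by exact_mod_cast hn⟩
    obtain ⟨hac, hbd⟩ := (three_dvd_form_iff₉ a b c d).1 h3
    obtain ⟨A, hA⟩ : (3 : ℤ) ∣ a + 2 * c := by omega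
    obtain ⟨C, hC⟩ : (3 : ℤ) ∣ -(2 * a + c) := by omega
    obtain ⟨B', hB⟩ : (3 : ℤ) ∣ -(b + 2 * d) := by omega
    obtain ⟨D, hD⟩ : (3 : ℤ) ∣ 2 * b + d := by omega
    refine ⟨_, mk_mem_lattice A B' C D, ?_⟩
    rw [basisJ_mul_mk]
    have ha : a = -A - 2 * C := by omega
    have hb : b = B' + 2 * D := by omega
    have hc : c = 2 * A + C := by omega
    have hd : d = -2 * B' - D := by omega
    subst ha hb hc hd
    rfl

/-- **`O₃j = jO₃`**: `x` is a right multiple of `j` from `O₃` iff it is a left multiple. [cite: VignerasLNM800, Ch. II §1 Lemme 1.5] -/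
theorem exists_eq_mul_basisJ_iff (x : ℍ[ℚ,-1,-3]) :
    (∃ y ∈ (Submodule.span ℤ (Set.range ![(⟨1, 0, 0, 0⟩ : ℍ[ℚ,-1,-3]), ⟨0, 1, 0, 0⟩, ⟨1/2, 0, 1/2, 0⟩, ⟨0, 1/2, 0, 1/2⟩])), x = y * ⟨0, 0, 1, 0⟩) ↔ ∃ y ∈ (Submodule.span ℤ (Set.range ![(⟨1, 0, 0, 0⟩ : ℍ[ℚ,-1,-3]), ⟨0, 1, 0, 0⟩, ⟨1/2, 0, 1/2, 0⟩, ⟨0, 1/2, 0, 1/2⟩])), x = ⟨0, 0, 1, 0⟩ * y := by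
  constructor
  · rintro ⟨y, hy, rfl⟩
    obtain ⟨a, b, c, d, rfl⟩ := (mem_lattice_iff y).1 hy
    exact ⟨_, mk_mem_lattice a (-b) c (-d), mk_mul_basisJ a b c d⟩
  · rintro ⟨y, hy, rfl⟩
    obtain ⟨a, b, c, d, rfl⟩ := (mem_lattice_iff y).1 hy
    refine ⟨_, mk_mem_lattice a (-b) c (-d), ?_⟩
    rw [basisJ_mul_mk_eq_mul_basisJ]

end Divisibility

/-! ## §3 The ideal `𝔓 = normPrimeIdeal O₃ 3 = jO₃` -/

section Ideal

/-- `x ∈ jO₃ ⟺ x = j·y` for some `y ∈ O₃` (`j` as a unit of `B`; the principal ideal `Ou = uO` of Vignéras). [cite: VignerasLNM800, Ch. II §1 Lemme 1.5] -/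
theorem mem_basisJUnit_smul_iff (x : ℍ[ℚ,-1,-3]) : x ∈ (⟨⟨0, 0, 1, 0⟩, ⟨0, 0, -1/3, 0⟩, basisJ_mul_basisJInv, basisJInv_mul_basisJ⟩ : (ℍ[ℚ,-1,-3])ˣ) • (Submodule.span ℤ (Set.range ![(⟨1, 0, 0, 0⟩ : ℍ[ℚ,-1,-3]), ⟨0, 1, 0, 0⟩, ⟨1/2, 0, 1/2, 0⟩, ⟨0, 1/2, 0, 1/2⟩])) ↔ ∃ y ∈ (Submodule.span ℤ (Set.range ![(⟨1, 0, 0, 0⟩ : ℍ[ℚ,-1,-3]), ⟨0, 1, 0, 0⟩, ⟨1/2, 0, 1/2, 0⟩, ⟨0, 1/2, 0, 1/2⟩])), x = ⟨0, 0, 1, 0⟩ * y := by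
  rw [mem_units_smul_submodule_iff, Units.smul_def, smul_eq_mul]
  constructor
  · intro h
    refine ⟨_, h, ?_⟩
    rw [← mul_assoc]
    change x = (((⟨⟨0, 0, 1, 0⟩, ⟨0, 0, -1/3, 0⟩, basisJ_mul_basisJInv, basisJInv_mul_basisJ⟩ : (ℍ[ℚ,-1,-3])ˣ) : (ℍ[ℚ,-1,-3])ˣ) : ℍ[ℚ,-1,-3]) * ((((⟨⟨0, 0, 1, 0⟩, ⟨0, 0, -1/3, 0⟩, basisJ_mul_basisJInv, basisJInv_mul_basisJ⟩ : (ℍ[ℚ,-1,-3])ˣ)⁻¹ : (ℍ[ℚ,-1,-3])ˣ)) : ℍ[ℚ,-1,-3]) * x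
    rw [Units.mul_inv, one_mul]
  · rintro ⟨y, hy, rfl⟩
    rw [← mul_assoc]
    change ((((⟨⟨0, 0, 1, 0⟩, ⟨0, 0, -1/3, 0⟩, basisJ_mul_basisJInv, basisJInv_mul_basisJ⟩ : (ℍ[ℚ,-1,-3])ˣ)⁻¹ : (ℍ[ℚ,-1,-3])ˣ)) : ℍ[ℚ,-1,-3]) * (((⟨⟨0, 0, 1, 0⟩, ⟨0, 0, -1/3, 0⟩, basisJ_mul_basisJInv, basisJInv_mul_basisJ⟩ : (ℍ[ℚ,-1,-3])ˣ) : (ℍ[ℚ,-1,-3])ˣ) : ℍ[ℚ,-1,-3]) * y ∈ (Submodule.span ℤ (Set.range ![(⟨1, 0, 0, 0⟩ : ℍ[ℚ,-1,-3]), ⟨0, 1, 0, 0⟩, ⟨1/2, 0, 1/2, 0⟩, ⟨0, 1/2, 0, 1/2⟩]))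
    rwa [Units.inv_mul, one_mul]

/-- **VIGNÉRAS II §1 LEMME 1.5 ∕ VOIGHT 13.3 for `O₃`: the prime ideal above the ramified prime `3` is principal, `𝔓 = jO₃`** —
`normPrimeIdeal O₃ 3` (the span of `{x ∈ O₃ : 3 ∣ nrd x}`) equals `jO₃`. [cite: VignerasLNM800, Ch. II §1 Lemme 1.5] [cite: Voight2021, §13.3 Thm. 13.3.11] -/
theorem normPrimeIdeal_three_eq : normPrimeIdeal (Submodule.span ℤ (Set.range ![(⟨1, 0, 0, 0⟩ : ℍ[ℚ,-1,-3]), ⟨0, 1, 0, 0⟩, ⟨1/2, 0, 1/2, 0⟩, ⟨0, 1/2, 0, 1/2⟩])) 3 = (⟨⟨0, 0, 1, 0⟩, ⟨0, 0, -1/3, 0⟩, basisJ_mul_basisJInv, basisJInv_mul_basisJ⟩ : (ℍ[ℚ,-1,-3])ˣ) • (Submodule.span ℤ (Set.range ![(⟨1, 0, 0, 0⟩ : ℍ[ℚ,-1,-3]), ⟨0, 1, 0, 0⟩, ⟨1/2, 0, 1/2, 0⟩, ⟨0, 1/2, 0, 1/2⟩])) := by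
  haveI := isQuaternionAlgebra
  haveI : Fact (Nat.Prime 3) := ⟨Nat.prime_three⟩
  have hdivp : ∀ X : ScalarExtension ℚ ℚ_[3] ℍ[ℚ,-1,-3], X ≠ 0 → IsUnit X :=
    EichlerPackage.forall_isUnit_scalarExtension_padic
      ({ B := ℍ[ℚ,-1,-3]
         instIsQuaternionAlgebra := isQuaternionAlgebra
         isTotallyDefinite := isTotallyDefinite
         mem_ramifiedPlaces_iff := mem_ramifiedPlaces_iff_three_mem
         O := (Submodule.span ℤ (Set.range ![(⟨1, 0, 0, 0⟩ : ℍ[ℚ,-1,-3]), ⟨0, 1, 0, 0⟩, ⟨1/2, 0, 1/2, 0⟩, ⟨0, 1/2, 0, 1/2⟩]))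
         isEichlerOrder := isEichlerOrder_one_lattice } : EichlerPackage 1 3) (dvd_refl 3)
  ext x
  rw [mem_normPrimeIdeal_iff hdivp isZOrder_lattice, mem_basisJUnit_smul_iff]
  constructor
  · rintro ⟨hx, hn⟩
    exact (exists_eq_basisJ_mul_iff hx).2 (by exact_mod_cast hn)
  · rintro ⟨y, hy, rfl⟩
    have hx : (⟨0, 0, 1, 0⟩ : ℍ[ℚ,-1,-3]) * y ∈ (Submodule.span ℤ (Set.range ![(⟨1, 0, 0, 0⟩ : ℍ[ℚ,-1,-3]), ⟨0, 1, 0, 0⟩, ⟨1/2, 0, 1/2, 0⟩, ⟨0, 1/2, 0, 1/2⟩])) := mul_mem_lattice basisJ_mem_lattice hy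
    exact ⟨hx, by exact_mod_cast (exists_eq_basisJ_mul_iff hx).1 ⟨y, hy, rfl⟩⟩

/-- **`𝔓 = jO₃ = O₃j` is two-sided.** [cite: VignerasLNM800, Ch. II §1 Lemme 1.5] -/
theorem coe_basisJUnit_smul_eq : (((⟨⟨0, 0, 1, 0⟩, ⟨0, 0, -1/3, 0⟩, basisJ_mul_basisJInv, basisJInv_mul_basisJ⟩ : (ℍ[ℚ,-1,-3])ˣ) • (Submodule.span ℤ (Set.range ![(⟨1, 0, 0, 0⟩ : ℍ[ℚ,-1,-3]), ⟨0, 1, 0, 0⟩, ⟨1/2, 0, 1/2, 0⟩, ⟨0, 1/2, 0, 1/2⟩])) : Submodule ℤ ℍ[ℚ,-1,-3]) : Set ℍ[ℚ,-1,-3]) = {x | ∃ y ∈ (Submodule.span ℤ (Set.range ![(⟨1, 0, 0, 0⟩ : ℍ[ℚ,-1,-3]), ⟨0, 1, 0, 0⟩, ⟨1/2, 0, 1/2, 0⟩, ⟨0, 1/2, 0, 1/2⟩])), x = y * ⟨0, 0, 1, 0⟩} := by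
  ext x
  rw [SetLike.mem_coe, mem_basisJUnit_smul_iff, Set.mem_setOf_eq, exists_eq_mul_basisJ_iff]

/-- **`[O₃ : 𝔓] = [O₃ : jO₃] = nrd(j)² = 9`** (`O₃/𝔓` has `9` elements). [cite: VignerasLNM800, Ch. II §1 Cor. 1.7] [cite: Voight2021, §13.3 Thm. 13.3.11] -/
theorem relIndex_basisJUnit_smul : ((⟨⟨0, 0, 1, 0⟩, ⟨0, 0, -1/3, 0⟩, basisJ_mul_basisJInv, basisJInv_mul_basisJ⟩ : (ℍ[ℚ,-1,-3])ˣ) • (Submodule.span ℤ (Set.range ![(⟨1, 0, 0, 0⟩ : ℍ[ℚ,-1,-3]), ⟨0, 1, 0, 0⟩, ⟨1/2, 0, 1/2, 0⟩, ⟨0, 1/2, 0, 1/2⟩]))).toAddSubgroup.relIndex ((Submodule.span ℤ (Set.range ![(⟨1, 0, 0, 0⟩ : ℍ[ℚ,-1,-3]), ⟨0, 1, 0, 0⟩, ⟨1/2, 0, 1/2, 0⟩, ⟨0, 1/2, 0, 1/2⟩]))).toAddSubgroup = 9 := by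
  haveI := isQuaternionAlgebra
  have hj : (((⟨⟨0, 0, 1, 0⟩, ⟨0, 0, -1/3, 0⟩, basisJ_mul_basisJInv, basisJInv_mul_basisJ⟩ : (ℍ[ℚ,-1,-3])ˣ) : (ℍ[ℚ,-1,-3])ˣ) : ℍ[ℚ,-1,-3]) ∈ leftOrder (Submodule.span ℤ (Set.range ![(⟨1, 0, 0, 0⟩ : ℍ[ℚ,-1,-3]), ⟨0, 1, 0, 0⟩, ⟨1/2, 0, 1/2, 0⟩, ⟨0, 1/2, 0, 1/2⟩])) := by
    rw [leftOrder_lattice]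
    exact basisJ_mem_lattice
  have h := Brandt.cast_relIndex_units_smul_eq_reducedNorm_sq isFullLattice_lattice hj
  have h3 : reducedNorm ℚ ℍ[ℚ,-1,-3] (((⟨⟨0, 0, 1, 0⟩, ⟨0, 0, -1/3, 0⟩, basisJ_mul_basisJInv, basisJInv_mul_basisJ⟩ : (ℍ[ℚ,-1,-3])ˣ) : (ℍ[ℚ,-1,-3])ˣ) : ℍ[ℚ,-1,-3]) = 3 := reducedNorm_basisJ
  rw [h3] at h
  have h' := h.trans (by norm_num : (3 : ℚ) ^ 2 = 9)
  exact_mod_cast h'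

/-- `[O₃ : normPrimeIdeal O₃ 3] = 9`. [cite: VignerasLNM800, Ch. II §1 Cor. 1.7] -/
theorem relIndex_normPrimeIdeal_three : (normPrimeIdeal (Submodule.span ℤ (Set.range ![(⟨1, 0, 0, 0⟩ : ℍ[ℚ,-1,-3]), ⟨0, 1, 0, 0⟩, ⟨1/2, 0, 1/2, 0⟩, ⟨0, 1/2, 0, 1/2⟩])) 3).toAddSubgroup.relIndex ((Submodule.span ℤ (Set.range ![(⟨1, 0, 0, 0⟩ : ℍ[ℚ,-1,-3]), ⟨0, 1, 0, 0⟩, ⟨1/2, 0, 1/2, 0⟩, ⟨0, 1/2, 0, 1/2⟩]))).toAddSubgroup = 9 := by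
  rw [normPrimeIdeal_three_eq, relIndex_basisJUnit_smul]

/-- **`𝔓² = j²O₃ = 3O₃`**: `x ∈ j(jO₃)` iff `x = 3y` with `y ∈ O₃`. [cite: VignerasLNM800, Ch. II §1 Cor. 1.7] -/
theorem mem_basisJUnit_smul_smul_iff (x : ℍ[ℚ,-1,-3]) : x ∈ (⟨⟨0, 0, 1, 0⟩, ⟨0, 0, -1/3, 0⟩, basisJ_mul_basisJInv, basisJInv_mul_basisJ⟩ : (ℍ[ℚ,-1,-3])ˣ) • ((⟨⟨0, 0, 1, 0⟩, ⟨0, 0, -1/3, 0⟩, basisJ_mul_basisJInv, basisJInv_mul_basisJ⟩ : (ℍ[ℚ,-1,-3])ˣ) • (Submodule.span ℤ (Set.range ![(⟨1, 0, 0, 0⟩ : ℍ[ℚ,-1,-3]), ⟨0, 1, 0, 0⟩, ⟨1/2, 0, 1/2, 0⟩, ⟨0, 1/2, 0, 1/2⟩]))) ↔ ∃ y ∈ (Submodule.span ℤ (Set.range ![(⟨1, 0, 0, 0⟩ : ℍ[ℚ,-1,-3]), ⟨0, 1, 0, 0⟩, ⟨1/2, 0, 1/2, 0⟩, ⟨0,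 1/2, 0, 1/2⟩])), x = (3 : ℚ) • y := by
  rw [smul_smul]
  have hjj : ((((⟨⟨0, 0, 1, 0⟩, ⟨0, 0, -1/3, 0⟩, basisJ_mul_basisJInv, basisJInv_mul_basisJ⟩ : (ℍ[ℚ,-1,-3])ˣ) * (⟨⟨0, 0, 1, 0⟩, ⟨0, 0, -1/3, 0⟩, basisJ_mul_basisJInv, basisJInv_mul_basisJ⟩ : (ℍ[ℚ,-1,-3])ˣ) : (ℍ[ℚ,-1,-3])ˣ)) : ℍ[ℚ,-1,-3]) = ⟨-3, 0, 0, 0⟩ := by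
    rw [Units.val_mul]
    exact basisJ_mul_basisJ
  have key : ∀ y : ℍ[ℚ,-1,-3], ((⟨⟨0, 0, 1, 0⟩, ⟨0, 0, -1/3, 0⟩, basisJ_mul_basisJInv, basisJInv_mul_basisJ⟩ : (ℍ[ℚ,-1,-3])ˣ) * (⟨⟨0, 0, 1, 0⟩, ⟨0, 0, -1/3, 0⟩, basisJ_mul_basisJInv, basisJInv_mul_basisJ⟩ : (ℍ[ℚ,-1,-3])ˣ)) • y = (3 : ℚ) • (-y) := fun y => by
    rw [Units.smul_def, hjj, smul_eq_mul]
    ext <;> simp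
  constructor
  · intro h
    rw [mem_units_smul_submodule_iff] at h
    refine ⟨-((((⟨⟨0, 0, 1, 0⟩, ⟨0, 0, -1/3, 0⟩, basisJ_mul_basisJInv, basisJInv_mul_basisJ⟩ : (ℍ[ℚ,-1,-3])ˣ) * (⟨⟨0, 0, 1, 0⟩, ⟨0, 0, -1/3, 0⟩, basisJ_mul_basisJInv, basisJInv_mul_basisJ⟩ : (ℍ[ℚ,-1,-3])ˣ))⁻¹ : (ℍ[ℚ,-1,-3])ˣ) • x), ((Submodule.span ℤ (Set.range ![(⟨1, 0, 0, 0⟩ : ℍ[ℚ,-1,-3]), ⟨0, 1, 0, 0⟩, ⟨1/2, 0, 1/2, 0⟩, ⟨0, 1/2, 0, 1/2⟩]))).neg_mem h, ?_⟩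
    rw [← key, smul_inv_smul]
  · rintro ⟨y, hy, rfl⟩
    have e : (3 : ℚ) • y = ((⟨⟨0, 0, 1, 0⟩, ⟨0, 0, -1/3, 0⟩, basisJ_mul_basisJInv, basisJInv_mul_basisJ⟩ : (ℍ[ℚ,-1,-3])ˣ) * (⟨⟨0, 0, 1, 0⟩, ⟨0, 0, -1/3, 0⟩, basisJ_mul_basisJInv, basisJInv_mul_basisJ⟩ : (ℍ[ℚ,-1,-3])ˣ)) • (-y) := by rw [key, neg_neg]
    rw [e]
    exact Submodule.smul_mem_pointwise_smul _ _ _ (((Submodule.span ℤ (Set.range ![(⟨1, 0, 0, 0⟩ : ℍ[ℚ,-1,-3]), ⟨0, 1, 0, 0⟩, ⟨1/2, 0, 1/2, 0⟩, ⟨0, 1/2, 0, 1/2⟩]))).neg_mem hy)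

/-- **Every `u ∈ O₃` of reduced norm `3` generates `𝔓`: `uO₃ = jO₃`** (`u = jε` with `ε ∈ O₃^×`; the `12` elements of reduced
norm `3` are the `jε` — one integral ideal of norm `3`, `T(3) = 1`). [cite: VignerasLNM800, Ch. II §1 Lemme 1.5] -/
theorem units_smul_eq_basisJUnit_smul_of_reducedNorm_eq_three (u : (ℍ[ℚ,-1,-3])ˣ) (hu : (u : ℍ[ℚ,-1,-3]) ∈ (Submodule.span ℤ (Set.range ![(⟨1, 0, 0, 0⟩ : ℍ[ℚ,-1,-3]), ⟨0, 1, 0, 0⟩, ⟨1/2, 0, 1/2, 0⟩, ⟨0, 1/2, 0, 1/2⟩])))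
    (h3 : reducedNorm ℚ ℍ[ℚ,-1,-3] (u : ℍ[ℚ,-1,-3]) = 3) : u • (Submodule.span ℤ (Set.range ![(⟨1, 0, 0, 0⟩ : ℍ[ℚ,-1,-3]), ⟨0, 1, 0, 0⟩, ⟨1/2, 0, 1/2, 0⟩, ⟨0, 1/2, 0, 1/2⟩])) = (⟨⟨0, 0, 1, 0⟩, ⟨0, 0, -1/3, 0⟩, basisJ_mul_basisJInv, basisJInv_mul_basisJ⟩ : (ℍ[ℚ,-1,-3])ˣ) • (Submodule.span ℤ (Set.range ![(⟨1, 0, 0, 0⟩ : ℍ[ℚ,-1,-3]), ⟨0, 1, 0, 0⟩, ⟨1/2, 0, 1/2, 0⟩, ⟨0, 1/2, 0, 1/2⟩])) := by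
  haveI := isQuaternionAlgebra
  obtain ⟨y, hy, huy⟩ := (exists_eq_basisJ_mul_iff hu).2 ⟨1, by rw [h3]; norm_num⟩
  have hy1 : reducedNorm ℚ ℍ[ℚ,-1,-3] y = 1 := by
    have h := h3
    rw [huy, reducedNorm_mul_holds ℚ ℍ[ℚ,-1,-3], reducedNorm_basisJ] at h
    linarith
  have hy0 : y ≠ 0 := by
    rintro rfl
    rw [mul_zero] at huy
    exact u.ne_zero huy
  set ε : (ℍ[ℚ,-1,-3])ˣ := (forall_isUnit y hy0).unit with hε
  have hεy : (ε : ℍ[ℚ,-1,-3]) = y := (forall_isUnit y hy0).unit_spec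
  have hεO : ε • (Submodule.span ℤ (Set.range ![(⟨1, 0, 0, 0⟩ : ℍ[ℚ,-1,-3]), ⟨0, 1, 0, 0⟩, ⟨1/2, 0, 1/2, 0⟩, ⟨0, 1/2, 0, 1/2⟩])) = (Submodule.span ℤ (Set.range ![(⟨1, 0, 0, 0⟩ : ℍ[ℚ,-1,-3]), ⟨0, 1, 0, 0⟩, ⟨1/2, 0, 1/2, 0⟩, ⟨0, 1/2, 0, 1/2⟩])) := (units_smul_lattice_eq_iff ε).2 ⟨by rw [hεy]; exact hy, by rw [hεy]; exact hy1⟩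
  have hu' : u = (⟨⟨0, 0, 1, 0⟩, ⟨0, 0, -1/3, 0⟩, basisJ_mul_basisJInv, basisJInv_mul_basisJ⟩ : (ℍ[ℚ,-1,-3])ˣ) * ε := by
    apply Units.ext
    rw [Units.val_mul, hεy]
    exact huy
  rw [hu', mul_smul, hεO]

end Ideal

end Literature.NumberTheory.Automorphic.MaxOrderDiscThree
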